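import Summits.QuantumFields.GaugeBoot.TiltedBoxTwoDimOddMidBlocks
import HarnessLib

/-!
# The odd square tilted box in two dimensions: the reduced-half energy of the link mirror and the twists of the three annuli (gauge-boot, L3 supplement: 2D slab gluing, reduced-half link mirror 3a/4)

HONEST FRAMING (cell `pub-gaugeboot`, page 1 of every file): the venture produces certified bounds
on lattice expectations at stated coupling, gauge group, dimension and torus size; NOT a mass gap,
NOT a continuum limit, NOT a string tension; NOT Yang–Mills-summit-bearing (barriers
`FixedCouplingUltralocality`, `PerturbativeInvisibility`). Bookkeeping for the POSITIVE two-dimensional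
result `TiltedBoxOddMidAxisRPTwoDim.lean`; it discharges nothing else.

Continuation of `TiltedBoxTwoDimOddMidBlocks.lean` (odd square box `ℤ^d/Γ(2P+1, 2P+1, L)`, two
dimensions, link mirror `Θ_mid : x_i ↦ 1 - x_i`, reduced half `{1 ≤ x_i ≤ P}`):

* `redWeight p ∈ {0, 1}` (`1` iff the plaquette is based in a layer `1 ≤ x_i ≤ P - 1`, i.e. all four
  links lie in the reduced half; two dimensions: every plaquette has an `i`-side), `redExpo` the
  half-weighted action `E`, and the cancellation identity **`redExpo_configMidReflect_add`**:
  `E(ΘU) + E(U) - S(U) = -∑_{slab 0 ∪ slab P ∪ slab (P+1)} (N - Re tr ρ(U_p))` — the half and its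
  mirror image cover every plaquette once, except the THREE annuli `0|1`, `P|P+1`, `P+1|P+2`;
  `plaqObs_eq_of_redWeight_ne_zero` (plaquettes of non-zero weight are read off the positive links);
* the twists of the annulus words: the lower annulus is exact (`upAt_zero_configMidReflect_odd`:
  `b_t(ΘU) = a_t(U)` through `0`), the letters of the free layer are shared by the two upper annuli
  (`loAt_oddLayerSite_add`), and the mirror image of the word of the layer `P` is a CONJUGATE of the word
  of the layer `P + 2` (`loAt_oddLayerSite_configMidReflect`, `oprod_upAt_succ_eq_conj`: the twist by
  `T` rotates the word by half its length).

References: K. Osterwalder, E. Seiler, Ann. Phys. 110 (1978) 440, §2; A. A. Migdal, Sov. Phys. JETP 42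
(1975) 413; J. Fröhlich, R. Israel, E. H. Lieb, B. Simon, J. Stat. Phys. 22 (1980) 297, §3.
-/

noncomputable section

open QuotientAddGroup Finset Function

namespace Summit.QuantumFields.GaugeBoot

namespace TiltedRP

namespace TwoDim

variable {d : ℕ} {i j : Fin d} {L P N : ℕ} [NeZero L] [NeZero P]
variable {G : Type*} [Group G]
variable (ρ : G →* Matrix (Fin N) (Fin N) ℂ)

/-! ## `ZMod (2P+1)`: the three rung layers -/

omit [NeZero L] [NeZero P] in
/-- `a = n ↔ a.val = n` for `n < 2P + 1`. [folklore] -/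
theorem eq_natCast_iff_val_eq_odd {a : ZMod (2 * P + 1)} {n : ℕ} (hn : n < 2 * P + 1) :
    a = ((n : ℕ) : ZMod (2 * P + 1)) ↔ a.val = n := by
  have hv : (((n : ℕ) : ZMod (2 * P + 1))).val = n := by rw [ZMod.val_natCast, Nat.mod_eq_of_lt hn]
  constructor
  · intro h; rw [h, hv]
  · intro h; apply ZMod.val_injective; rw [h, hv]

omit [NeZero L] in
/-- The three rung layers `0`, `P`, `P + 1` as classes and as values. [folklore] -/
theorem rungLayer_iff (a : ZMod (2 * P + 1)) :
    (a = 0 ∨ a = ((P : ℕ) : ZMod (2 * P + 1)) ∨ a = ((P : ℕ) : ZMod (2 * P + 1)) + 1) ↔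
      (a.val = 0 ∨ a.val = P ∨ a.val = P + 1) := by
  have hP : 1 ≤ P := one_le_P
  have h1 : ((P : ℕ) : ZMod (2 * P + 1)) + 1 = ((P + 1 : ℕ) : ZMod (2 * P + 1)) := by push_cast; ring
  rw [h1, ← ZMod.val_eq_zero, eq_natCast_iff_val_eq_odd (by omega), eq_natCast_iff_val_eq_odd (by omega)]

/-! ## The reduced-half weights and the energy -/

/-- **The reduced-half weight of a plaquette** of the odd box: `1` if it is based in a layer
`1 ≤ x_i ≤ P - 1` (in two dimensions: iff all four links lie in `{1 ≤ x_i ≤ P}`), `0` otherwise. -/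
def redWeight (p : Plaq (TiltedSite d i j (2 * P + 1) (2 * P + 1) L) d) : ℝ :=
  if 1 ≤ (axisCoord d L (2 * P + 1) p.1).val ∧ (axisCoord d L (2 * P + 1) p.1).val + 1 ≤ P then 1 else 0

/-- The half-weighted action `E(U) = ∑_p c_p (N - Re tr ρ(U_p))` of the reduced half. -/
def redExpo (U : Config (TiltedSite d i j (2 * P + 1) (2 * P + 1) L) d G) : ℝ :=
  ∑ p : Plaq (TiltedSite d i j (2 * P + 1) (2 * P + 1) L) d,
    redWeight p * ((N : ℝ) - plaqObs ρ (tiltedUnit d i j (2 * P + 1) (2 * P + 1) L) p U)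

omit [NeZero P] in
/-- `E` is continuous. [folklore] -/
theorem continuous_redExpo [TopologicalSpace G] [IsTopologicalGroup G] (hρ : Continuous ρ) :
    Continuous fun U : Config (TiltedSite d i j (2 * P + 1) (2 * P + 1) L) d G => redExpo ρ U :=
  continuous_finsetSum _ fun p _ => continuous_const.mul (continuous_const.sub (continuous_plaqObs ρ hρ _ p))

omit [NeZero L] [NeZero P] in
/-- **The cancellation identity** (two dimensions): `c_p + c_{Θp} = 0` for the plaquettes of the three
annuli (based in the layers `0`, `P`, `P + 1`), `= 1` for all others. [folklore] -/
theorem redWeight_add_redWeight_plaqMidReflect (hij : i ≠ j) (hd : ∀ k : Fin d, k = i ∨ k = j)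
    (p : Plaq (TiltedSite d i j (2 * P + 1) (2 * P + 1) L) d) :
    redWeight p + redWeight (plaqMidReflect (tiltedUnit d i j (2 * P + 1) (2 * P + 1) L) i
      (tiltedAxisFlip d L (2 * P + 1) hij) p) =
      if (axisCoord d L (2 * P + 1) p.1).val = 0 ∨ (axisCoord d L (2 * P + 1) p.1).val = P ∨
          (axisCoord d L (2 * P + 1) p.1).val = P + 1 then 0 else 1 := by
  have hp : HasDir p i := hasDir_left hij hd p
  have hc := ZMod.val_lt (axisCoord d L (2 * P + 1) p.1)
  unfold redWeight
  rw [plaqMidReflect_fst_of_hasDir hp, val_axisCoord_tiltedAxisFlip_odd hij]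
  by_cases h0 : axisCoord d L (2 * P + 1) p.1 = 0
  · have hv : (axisCoord d L (2 * P + 1) p.1).val = 0 := by rw [h0, ZMod.val_zero]
    rw [if_pos h0, hv]
    norm_num
  · have hv : (axisCoord d L (2 * P + 1) p.1).val ≠ 0 := fun h => h0 ((ZMod.val_eq_zero _).1 h)
    rw [if_neg h0]
    split_ifs <;> first | (norm_num; done) | (exfalso; omega)

/-- **`E(ΘU) + E(U) - S(U) = -∑_{slab 0 ∪ slab P ∪ slab (P+1)} (N - Re tr ρ(U_p))`** (two dimensions):
the reduced half and its mirror image cover every plaquette once, except the three annuli. [folklore] -/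
theorem redExpo_configMidReflect_add [TopologicalSpace G] [IsTopologicalGroup G] [CompactSpace G]
    (hij : i ≠ j) (hd : ∀ k : Fin d, k = i ∨ k = j) (hρ : Continuous ρ)
    (U : Config (TiltedSite d i j (2 * P + 1) (2 * P + 1) L) d G) :
    redExpo ρ (configMidReflect (tiltedUnit d i j (2 * P + 1) (2 * P + 1) L) i (tiltedAxisFlip d L (2 * P + 1) hij) U) +
      redExpo ρ U - wilsonAction ρ (tiltedUnit d i j (2 * P + 1) (2 * P + 1) L) U =
      -∑ p ∈ Finset.univ.filter (fun p => SquareSlab.IsSlabPlaq (0 : ZMod (2 * P + 1)) p ∨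
          SquareSlab.IsSlabPlaq ((P : ℕ) : ZMod (2 * P + 1)) p ∨
          SquareSlab.IsSlabPlaq (((P : ℕ) : ZMod (2 * P + 1)) + 1) p),
        ((N : ℝ) - plaqObs ρ (tiltedUnit d i j (2 * P + 1) (2 * P + 1) L) p U) := by
  have hF : IsAxisFlip (tiltedUnit d i j (2 * P + 1) (2 * P + 1) L) i (tiltedAxisFlip d L (2 * P + 1) hij) :=
    isAxisFlip_tiltedAxisFlip d L (2 * P + 1) hij
  have h1 : redExpo ρ (configMidReflect (tiltedUnit d i j (2 * P + 1) (2 * P + 1) L) i (tiltedAxisFlip d L (2 * P + 1) hij) U) =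
      ∑ p : Plaq (TiltedSite d i j (2 * P + 1) (2 * P + 1) L) d,
        redWeight (plaqMidReflect (tiltedUnit d i j (2 * P + 1) (2 * P + 1) L) i (tiltedAxisFlip d L (2 * P + 1) hij) p) *
          ((N : ℝ) - plaqObs ρ (tiltedUnit d i j (2 * P + 1) (2 * P + 1) L) p U) := by
    unfold redExpo
    have h := hF.sum_plaqMidReflect_configMidReflect ρ hρ
      (fun p => redWeight (plaqMidReflect (tiltedUnit d i j (2 * P + 1) (2 * P + 1) L) i (tiltedAxisFlip d L (2 * P + 1) hij) p))
      (fun r => (N : ℝ) - r) U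
    simp only [hF.plaqMidReflect_plaqMidReflect] at h
    exact h
  rw [h1, redExpo, wilsonAction, ← Finset.sum_add_distrib, ← Finset.sum_sub_distrib, ← Finset.sum_neg_distrib,
    Finset.sum_filter]
  refine Finset.sum_congr rfl fun p _ => ?_
  have h2 := redWeight_add_redWeight_plaqMidReflect hij hd p
  rw [add_comm] at h2
  have hp : HasDir p i := hasDir_left hij hd p
  have hiff : (SquareSlab.IsSlabPlaq (0 : ZMod (2 * P + 1)) p ∨ SquareSlab.IsSlabPlaq ((P : ℕ) : ZMod (2 * P + 1)) p ∨
      SquareSlab.IsSlabPlaq (((P : ℕ) : ZMod (2 * P + 1)) + 1) p) ↔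
      ((axisCoord d L (2 * P + 1) p.1).val = 0 ∨ (axisCoord d L (2 * P + 1) p.1).val = P ∨
        (axisCoord d L (2 * P + 1) p.1).val = P + 1) := by
    unfold SquareSlab.IsSlabPlaq
    rw [← rungLayer_iff]
    have hp' : p.2.1.1 = i ∨ p.2.1.2 = i := hp
    simp only [hp', true_and]
  by_cases hs : SquareSlab.IsSlabPlaq (0 : ZMod (2 * P + 1)) p ∨ SquareSlab.IsSlabPlaq ((P : ℕ) : ZMod (2 * P + 1)) p ∨
      SquareSlab.IsSlabPlaq (((P : ℕ) : ZMod (2 * P + 1)) + 1) p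
  · rw [if_pos (hiff.1 hs)] at h2; rw [if_pos hs]
    linear_combination ((N : ℝ) - plaqObs ρ (tiltedUnit d i j (2 * P + 1) (2 * P + 1) L) p U) * h2
  · rw [if_neg (fun h => hs (hiff.2 h))] at h2; rw [if_neg hs]
    linear_combination ((N : ℝ) - plaqObs ρ (tiltedUnit d i j (2 * P + 1) (2 * P + 1) L) p U) * h2

/-! ## Plaquettes of non-zero weight are read off the positive links -/

omit [NeZero P] in
/-- A link based in a layer `1 ≤ x_i ≤ P - 1`, in direction `i` or `j`, is positive. [folklore] -/
theorem mem_posBlockR_of_base {x : TiltedSite d i j (2 * P + 1) (2 * P + 1) L}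
    (hx : 1 ≤ (axisCoord d L (2 * P + 1) x).val ∧ (axisCoord d L (2 * P + 1) x).val + 1 ≤ P) {m : Fin d}
    (hm : m = i ∨ m = j) : (x, m) ∈ posBlockR d i j L P := by
  have h2 : (axisCoord d L (2 * P + 1) x).val ≤ P := by have := hx.2; omega
  rw [mem_posBlockR]
  rcases hm with rfl | rfl
  · exact Or.inr ⟨rfl, hx.1, hx.2⟩
  · exact Or.inl ⟨rfl, hx.1, h2⟩

/-- The far links of a plaquette based in a layer `1 ≤ x_i ≤ P - 1` are positive. [folklore] -/
theorem mem_posBlockR_step (hij : i ≠ j) {x : TiltedSite d i j (2 * P + 1) (2 * P + 1) L}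
    (hx : 1 ≤ (axisCoord d L (2 * P + 1) x).val ∧ (axisCoord d L (2 * P + 1) x).val + 1 ≤ P) {a b : Fin d}
    (ha : a = i ∨ a = j) (hb : b = i ∨ b = j) (hab : a ≠ b) :
    (x + tiltedUnit d i j (2 * P + 1) (2 * P + 1) L a, b) ∈ posBlockR d i j L P := by
  have hP : 1 ≤ P := one_le_P
  rw [mem_posBlockR]
  simp only
  rw [axisCoord_add_tiltedUnit]
  rcases ha with rfl | rfl <;> rcases hb with rfl | rfl
  · exact (hab rfl).elim
  · rw [if_pos rfl, val_add_one_of_le (by omega) hP]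
    exact Or.inl ⟨rfl, by omega, hx.2⟩
  · rw [if_neg (Ne.symm hij), add_zero]
    exact Or.inr ⟨rfl, hx.1, hx.2⟩
  · exact (hab rfl).elim

omit [NeZero P] in
/-- **A plaquette of non-zero weight is read off the positive links** (two dimensions). [folklore] -/
theorem plaqObs_eq_of_redWeight_ne_zero [NeZero P] (hij : i ≠ j) (hd : ∀ k : Fin d, k = i ∨ k = j)
    {U V : Config (TiltedSite d i j (2 * P + 1) (2 * P + 1) L) d G} (hUV : ∀ l ∈ posBlockR d i j L P, U l = V l)
    {p : Plaq (TiltedSite d i j (2 * P + 1) (2 * P + 1) L) d} (hp : redWeight p ≠ 0) :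
    plaqObs ρ (tiltedUnit d i j (2 * P + 1) (2 * P + 1) L) p U = plaqObs ρ (tiltedUnit d i j (2 * P + 1) (2 * P + 1) L) p V := by
  have hx : 1 ≤ (axisCoord d L (2 * P + 1) p.1).val ∧ (axisCoord d L (2 * P + 1) p.1).val + 1 ≤ P := by
    unfold redWeight at hp
    by_contra h
    exact hp (if_neg h)
  have hne : p.2.1.1 ≠ p.2.1.2 := ne_of_lt p.2.2
  unfold plaqObs
  rw [holonomy_congr _ p.1 p.2.1.1 p.2.1.2 (hUV _ (mem_posBlockR_of_base hx (hd _)))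
    (hUV _ (mem_posBlockR_step hij hx (hd _) (hd _) hne)) (hUV _ (mem_posBlockR_step hij hx (hd _) (hd _) hne.symm))
    (hUV _ (mem_posBlockR_of_base hx (hd _)))]

/-- `E` depends only on the positive links (two dimensions). [folklore] -/
theorem redExpo_eq_of_posLinks (hij : i ≠ j) (hd : ∀ k : Fin d, k = i ∨ k = j)
    {U V : Config (TiltedSite d i j (2 * P + 1) (2 * P + 1) L) d G} (hUV : ∀ l ∈ posBlockR d i j L P, U l = V l) :
    redExpo ρ U = redExpo ρ V := by
  unfold redExpo
  refine Finset.sum_congr rfl fun p _ => ?_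
  by_cases hp : redWeight p = 0
  · rw [hp, zero_mul, zero_mul]
  · rw [plaqObs_eq_of_redWeight_ne_zero ρ hij hd hUV hp]

/-! ## The twists of the three annulus words -/

omit [NeZero L] [NeZero P] in
/-- **The lower annulus is exact**: `b_t(ΘU) = a_t(U)` through `0` (`θ(y + e_i) = σ y = y` on the
layer `0`). [folklore] -/
theorem upAt_zero_configMidReflect_odd (hij : i ≠ j) (t : ℕ) (U : Config (TiltedSite d i j (2 * P + 1) (2 * P + 1) L) d G) :
    upAt (0 : TiltedSite d i j (2 * P + 1) (2 * P + 1) L) t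
        (configMidReflect (tiltedUnit d i j (2 * P + 1) (2 * P + 1) L) i (tiltedAxisFlip d L (2 * P + 1) hij) U) =
      loAt (0 : TiltedSite d i j (2 * P + 1) (2 * P + 1) L) t U := by
  unfold upAt loAt
  rw [configMidReflect_other _ i _ U _ (Ne.symm hij), (isAxisFlip_tiltedAxisFlip d L (2 * P + 1) hij).midReflect_add_self,
    tiltedAxisFlip_eq_self_of_axisCoord_eq_zero d L (2 * P + 1) hij _ (by rw [axisCoord_cyc hij, map_zero])]

omit [NeZero L] [NeZero P] in
/-- The reflected upper word of the lower annulus IS the lower word. [folklore] -/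
theorem oprod_upAt_zero_configMidReflect_odd (hij : i ≠ j) (n : ℕ) (U : Config (TiltedSite d i j (2 * P + 1) (2 * P + 1) L) d G) :
    SlabKernel.oprod (upAt (0 : TiltedSite d i j (2 * P + 1) (2 * P + 1) L)) n
        (configMidReflect (tiltedUnit d i j (2 * P + 1) (2 * P + 1) L) i (tiltedAxisFlip d L (2 * P + 1) hij) U) =
      SlabKernel.oprod (loAt (0 : TiltedSite d i j (2 * P + 1) (2 * P + 1) L)) n U := by
  unfold SlabKernel.oprod
  congr 1
  exact List.map_congr_left fun t _ => upAt_zero_configMidReflect_odd hij t U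

omit [NeZero L] [NeZero P] in
/-- The cycle through `y₀ + e_i` is the cycle through `y₀`, shifted by `e_i`. [folklore] -/
theorem cyc_oddLayerSite_add (t : ℕ) :
    cyc (oddLayerSite d i j L P + tiltedUnit d i j (2 * P + 1) (2 * P + 1) L i) t =
      cyc (oddLayerSite d i j L P) t + tiltedUnit d i j (2 * P + 1) (2 * P + 1) L i := by
  unfold cyc
  abel

omit [NeZero L] [NeZero P] [Group G] in
/-- **The letters of the free layer are shared**: the lower letters of the annulus through `y₀ + e_i`
are the upper letters of the annulus through `y₀`. [folklore] -/
theorem loAt_oddLayerSite_add (t : ℕ) (U : Config (TiltedSite d i j (2 * P + 1) (2 * P + 1) L) d G) :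
    loAt (oddLayerSite d i j L P + tiltedUnit d i j (2 * P + 1) (2 * P + 1) L i) t U = upAt (oddLayerSite d i j L P) t U := by
  unfold loAt upAt
  rw [cyc_oddLayerSite_add]

omit [NeZero L] [NeZero P] in
/-- **The upper annulus is twisted**: `a_t(ΘU) = c_{t+M}(U)` where `a_t` are the letters of the layer
`P` (through `y₀`) and `c_t` the letters of the layer `P + 2` (upper letters through `y₀ + e_i`),
`M = 2P + 1` (`θ y = σ y + e_i = y + (M) e_j + 2 e_i` on the layer `P`). [folklore] -/
theorem loAt_oddLayerSite_configMidReflect (hij : i ≠ j) (t : ℕ) (U : Config (TiltedSite d i j (2 * P + 1) (2 * P + 1) L) d G) :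
    loAt (oddLayerSite d i j L P) t
        (configMidReflect (tiltedUnit d i j (2 * P + 1) (2 * P + 1) L) i (tiltedAxisFlip d L (2 * P + 1) hij) U) =
      upAt (oddLayerSite d i j L P + tiltedUnit d i j (2 * P + 1) (2 * P + 1) L i) (t + (2 * P + 1)) U := by
  unfold loAt upAt
  rw [configMidReflect_other _ i _ U _ (Ne.symm hij), midReflect, tiltedAxisFlip_cyc hij, cyc_oddLayerSite_add]

omit [NeZero L] [NeZero P] in
/-- **The twist is a conjugation of the word of the layer `P + 2`**: `∏_{t<2M} c_t(U) = c · (∏_{t<2M} a_t(ΘU)) · c⁻¹`,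
`c = c_0 ⋯ c_{M-1}`, `M = 2P + 1`. [folklore] -/
theorem oprod_upAt_succ_eq_conj (hij : i ≠ j) (U : Config (TiltedSite d i j (2 * P + 1) (2 * P + 1) L) d G) :
    SlabKernel.oprod (upAt (oddLayerSite d i j L P + tiltedUnit d i j (2 * P + 1) (2 * P + 1) L i)) (2 * (2 * P + 1)) U =
      SlabKernel.oprod (upAt (oddLayerSite d i j L P + tiltedUnit d i j (2 * P + 1) (2 * P + 1) L i)) (2 * P + 1) U *
        SlabKernel.oprod (loAt (oddLayerSite d i j L P)) (2 * (2 * P + 1))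
          (configMidReflect (tiltedUnit d i j (2 * P + 1) (2 * P + 1) L) i (tiltedAxisFlip d L (2 * P + 1) hij) U) *
        (SlabKernel.oprod (upAt (oddLayerSite d i j L P + tiltedUnit d i j (2 * P + 1) (2 * P + 1) L i)) (2 * P + 1) U)⁻¹ := by
  set y := oddLayerSite d i j L P + tiltedUnit d i j (2 * P + 1) (2 * P + 1) L i with hy
  have hΘ : SlabKernel.oprod (loAt (oddLayerSite d i j L P)) (2 * (2 * P + 1))
      (configMidReflect (tiltedUnit d i j (2 * P + 1) (2 * P + 1) L) i (tiltedAxisFlip d L (2 * P + 1) hij) U) =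
      SlabKernel.oprod (fun t => upAt y ((2 * P + 1) + t)) (2 * (2 * P + 1)) U := by
    unfold SlabKernel.oprod
    congr 1
    refine List.map_congr_left fun t _ => ?_
    rw [loAt_oddLayerSite_configMidReflect hij, add_comm t (2 * P + 1)]
  rw [hΘ, show 2 * (2 * P + 1) = (2 * P + 1) + (2 * P + 1) from two_mul _,
    SlabKernel.oprod_add (upAt y) (2 * P + 1) (2 * P + 1) U,
    SlabKernel.oprod_add (fun t => upAt y ((2 * P + 1) + t)) (2 * P + 1) (2 * P + 1) U]
  have hper : SlabKernel.oprod (fun t => upAt y ((2 * P + 1) + ((2 * P + 1) + t))) (2 * P + 1) U =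
      SlabKernel.oprod (upAt y) (2 * P + 1) U := by
    unfold SlabKernel.oprod
    congr 1
    refine List.map_congr_left fun t _ => ?_
    show upAt y ((2 * P + 1) + ((2 * P + 1) + t)) U = upAt y t U
    rw [show (2 * P + 1) + ((2 * P + 1) + t) = t + 2 * (2 * P + 1) by ring, upAt_add_two_mul hij]
  rw [hper]
  group

end TwoDim

end TiltedRP

end Summit.QuantumFields.GaugeBoot

end
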